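import Summits.NavierStokesRegularity.NavierStokesRegularity.Theorems.TypeILiouvilleTypeIliouvilleNoTypeIIASlabModL
import Literature.Analysis.FunctionSpaces.WeakLpQuantitative
import HarnessLib

/-!
# Modulo KNSS's (L): the weak-`L³` slab bound is a Type-I / continuation criterion
# (crux `TypeIliouvilleNoTypeII`, stmt-NavierStokesRegularity-0056; hard core (L) = `TypeIliouvilleL`,
# stmt-NavierStokesRegularity-10661; §B REACH class C2)

Helper file (theorems only).  `…ASlabModL.lean` proved `Clay (A) ⇐ ASlab ∧ (L)`, ASlab being the
bound of the scaled local kinetic energy `A(ũ; Q_r(z)) = ess sup_t r⁻¹ ∫_{B_r} |ũ(t)|²` on the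
parabolic balls of a final slab of the viscosity-normalised field `ũ = timeRescale ν⁻¹ ν⁻¹ u`.  The
critics' REACH class C2 — a bound on the critical WEAK-`L³` quasinorm `sup_t ‖u(t)‖_{L^{3,∞}}` — sits
above ASlab: by the layer-cake bound `L^{3,∞} ⊂ L²_uloc` at height `λ = 1/r`
(`Literature.Analysis.FunctionSpaces.MemWeakLp.setLIntegral_rpow_le`, Bradshaw–Tsai 2017 §1),

  `r⁻¹ ∫_{B_r(x₀)} |f|² ≤ |B₁| + 2 · sup_t t³ |{|f| > t}|`      (`inv_mul_setLIntegral_ball_le`),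

uniformly in `r > 0` and `x₀`.  Hence (this file):

* `cknAEss_le_of_eWeakLpPow_le` — a weak-`L³` bound `W` on the slices of `ũ` over a time interval
  bounds `A(ũ; Q) ≤ |B₁| + 2W` on every parabolic ball `Q` inside that slab;
* `isTypeIBlowup_of_weakL3Slab_of_liouvilleL` — per solution, MODULO (L): a maximal Leray–Hopf
  solution from a rapidly decaying datum whose normalised slices have `sup_{s ∈ (S₁, νT)} ‖ũ(s)‖³_{L^{3,∞}} ≤ W < ∞`
  blows up at the Type-I rate (`isTypeIBlowup_of_cknAEssSlab_of_liouvilleL`);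
* `not_isMaximal_of_weakL3Slab_of_liouvilleL` — **(L) implies the critical weak-`L³` continuation
  criterion**: under (L), a classical Leray–Hopf solution on `[0, T)` from a rapidly decaying datum
  with such a weak-`L³` slab bound is NOT maximal at `T` ((L) also forbids the Type-I rate:
  `typeILiouville_typeIliouvilleLKillsTypeI_proof`), i.e. it extends past `T`
  (`hasSmoothExtensionPast_of_weakL3Slab_of_liouvilleL`).

WHAT THIS IS NOT: not NS regularity and not the (open) `L^∞_t L^{3,∞}_x` regularity theorem — both
conclusions are MODULO the hard core (L); the point recorded for the §B cell is that C2, like ASlab,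
reaches C3 = 0056 once (L) is paid (route `TypeILiouville`).
-/

noncomputable section

-- the summit and its single problem share the name `NavierStokesRegularity` (D-0017 nested layout)
set_option linter.dupNamespace false

open Set Function Filter Topology MeasureTheory Metric
open scoped NNReal ENNReal

namespace Summit.NavierStokesRegularity.NavierStokesRegularity.Theorems.TypeIliouvilleNoTypeII.TypeIIZoom

open Literature.Analysis Literature.Analysis.FluidPDE Literature.Analysis.FunctionSpaces
open Summit.NavierStokesRegularity.NavierStokesRegularity.Theses.TypeILiouville (TypeIliouvilleL
  TypeIliouvilleNoTypeII)

/-! ## Weak-`L³` controls the scaled local kinetic energy -/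

/-- **`L^{3,∞} ⊂ L²_uloc`, scale-invariantly**: for an a.e.-strongly measurable `f : ℝ³ → ℝ³`,
`r > 0` and any centre, `r⁻¹ ∫_{B_r(x₀)} ‖f‖² ≤ |B₁| + 2 · eWeakLpPow f 3` (the layer-cake bound of
`MemWeakLp.setLIntegral_rpow_le` with `p = 3`, `r = 2` at height `λ = 1/r`). [cite: BradshawTsai2017AHP, §1 (L^3_w ⊂ L^2_uloc)] -/
theorem inv_mul_setLIntegral_ball_le {f : EuclideanSpace ℝ (Fin 3) → EuclideanSpace ℝ (Fin 3)}
    (hf : AEStronglyMeasurable f volume) {r : ℝ} (hr : 0 < r) (x₀ : EuclideanSpace ℝ (Fin 3)) :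
    (ENNReal.ofReal r)⁻¹ * ∫⁻ x in ball x₀ r, ‖f x‖ₑ ^ 2 ≤
      volume (ball (0 : EuclideanSpace ℝ (Fin 3)) 1) + 2 * eWeakLpPow f 3 volume := by
  set W : ℝ≥0∞ := eWeakLpPow f 3 volume with hW
  have hr0 : ENNReal.ofReal r ≠ 0 := (ENNReal.ofReal_pos.2 hr).ne'
  -- the layer-cake bound at height `1/r`
  have h := MemWeakLp.setLIntegral_rpow_le (p := 3) (μ := volume) hf (r := 2) two_pos
    (by rw [ENNReal.toReal_ofNat]; norm_num) (ball x₀ r) (lam := r⁻¹) (inv_pos.2 hr)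
  have e1 : ENNReal.ofReal ((r⁻¹) ^ (2 : ℝ)) = ENNReal.ofReal (r ^ 2)⁻¹ := by
    rw [Real.rpow_two, inv_pow]
  have e2 : ENNReal.ofReal (2 / ((3 : ℝ≥0∞).toReal - 2) * r⁻¹ ^ ((2 : ℝ) - (3 : ℝ≥0∞).toReal)) =
      ENNReal.ofReal (2 * r) := by
    rw [ENNReal.toReal_ofNat, show (2 : ℝ) - 3 = -1 by norm_num, Real.rpow_neg_one, inv_inv]
    norm_num
  have hlhs : ∫⁻ x in ball x₀ r, ‖f x‖ₑ ^ 2 = ∫⁻ x in ball x₀ r, ‖f x‖ₑ ^ (2 : ℝ) :=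
    lintegral_congr fun x => by rw [← ENNReal.rpow_natCast]; norm_num
  rw [e1, e2, Measure.addHaar_ball_of_pos volume x₀ hr, finrank_euclideanSpace_fin] at h
  -- `|B_r| r⁻² + 2 r W = r (|B₁| + 2 W)`
  have hvol : ENNReal.ofReal (r ^ 3) * volume (ball (0 : EuclideanSpace ℝ (Fin 3)) 1) *
      ENNReal.ofReal (r ^ 2)⁻¹ =
        ENNReal.ofReal r * volume (ball (0 : EuclideanSpace ℝ (Fin 3)) 1) := by
    have e : ENNReal.ofReal (r ^ 3) * ENNReal.ofReal (r ^ 2)⁻¹ = ENNReal.ofReal r := by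
      rw [← ENNReal.ofReal_mul (by positivity)]
      congr 1
      field_simp
    calc ENNReal.ofReal (r ^ 3) * volume (ball (0 : EuclideanSpace ℝ (Fin 3)) 1) *
          ENNReal.ofReal (r ^ 2)⁻¹
        = ENNReal.ofReal (r ^ 3) * ENNReal.ofReal (r ^ 2)⁻¹ *
            volume (ball (0 : EuclideanSpace ℝ (Fin 3)) 1) := by ring
      _ = ENNReal.ofReal r * volume (ball (0 : EuclideanSpace ℝ (Fin 3)) 1) := by rw [e]
  have h2r : ENNReal.ofReal (2 * r) = 2 * ENNReal.ofReal r := by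
    rw [ENNReal.ofReal_mul zero_le_two, ENNReal.ofReal_ofNat]
  have hmain : ∫⁻ x in ball x₀ r, ‖f x‖ₑ ^ 2 ≤
      ENNReal.ofReal r * (volume (ball (0 : EuclideanSpace ℝ (Fin 3)) 1) + 2 * W) := by
    rw [hlhs]
    refine h.trans (le_of_eq ?_)
    rw [hvol, h2r]
    ring
  calc (ENNReal.ofReal r)⁻¹ * ∫⁻ x in ball x₀ r, ‖f x‖ₑ ^ 2
      ≤ (ENNReal.ofReal r)⁻¹ * (ENNReal.ofReal r *
          (volume (ball (0 : EuclideanSpace ℝ (Fin 3)) 1) + 2 * W)) := mul_le_mul' le_rfl hmain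
    _ = volume (ball (0 : EuclideanSpace ℝ (Fin 3)) 1) + 2 * W := by
        rw [← mul_assoc, ENNReal.inv_mul_cancel hr0 ENNReal.ofReal_ne_top, one_mul]

/-- **A weak-`L³` slab bound controls `A` on every ball of the slab.**  If the slices `w(s)`,
`s ∈ (S₁, S₂)`, are a.e.-strongly measurable with `eWeakLpPow (w s) 3 ≤ W`, then
`A_ess(w; Q_r(z)) ≤ |B₁| + 2W` for every parabolic ball `Q_r(z) ⊆ (S₁, S₂) × ℝ³`, `r > 0`. [cite: BradshawTsai2017AHP, §1] -/
theorem cknAEss_le_of_eWeakLpPow_le {w : ℝ → EuclideanSpace ℝ (Fin 3) → EuclideanSpace ℝ (Fin 3)}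
    {S₁ S₂ : ℝ} {W : ℝ≥0∞}
    (hmeas : ∀ s ∈ Ioo S₁ S₂, AEStronglyMeasurable (w s) volume)
    (hW : ∀ s ∈ Ioo S₁ S₂, eWeakLpPow (w s) 3 volume ≤ W)
    {r : ℝ} (hr : 0 < r) {z : ℝ × EuclideanSpace ℝ (Fin 3)}
    (hQ : parabolicCylinder r z ⊆ Ioo S₁ S₂ ×ˢ univ) :
    cknAEss r z w ≤ volume (ball (0 : EuclideanSpace ℝ (Fin 3)) 1) + 2 * W := by
  unfold cknAEss
  refine essSup_le_of_ae_le _ (ae_restrict_of_forall_mem measurableSet_Ioo fun t ht => ?_)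
  have hmem : (t, z.2) ∈ parabolicCylinder r z := by
    rw [mem_parabolicCylinder]
    exact ⟨ht, by simpa using hr⟩
  have htS : t ∈ Ioo S₁ S₂ := (hQ hmem).1
  exact (inv_mul_setLIntegral_ball_le (hmeas t htS) hr z.2).trans
    (add_le_add le_rfl (mul_le_mul' le_rfl (hW t htS)))

/-! ## Modulo (L): weak-`L³` ⇒ Type I, and the continuation criterion -/

variable {ν T : ℝ} {u : ℝ → EuclideanSpace ℝ (Fin 3) → EuclideanSpace ℝ (Fin 3)}
  {p : ℝ → EuclideanSpace ℝ (Fin 3) → ℝ}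

/-- **Weak-`L³` slab bound ⇒ Type-I rate, modulo (L), per solution.**  Let `(u, p)` be maximal
with lifespan `T`, Leray–Hopf from a rapidly decaying datum, and suppose the slices of its
normalised field `ũ = timeRescale ν⁻¹ ν⁻¹ u` on a final slab `(S₁, νT)` are a.e.-strongly measurable
with weak-`L³` quasinorm `eWeakLpPow (ũ s) 3 ≤ W ≠ ∞`.  Under KNSS's (L) the solution is Type I at
`T` (`cknAEss_le_of_eWeakLpPow_le` + `isTypeIBlowup_of_cknAEssSlab_of_liouvilleL`). [cite: KochNadirashviliSereginSverak2009, §1 conjecture (L) (arXiv:0709.3599)] -/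
theorem isTypeIBlowup_of_weakL3Slab_of_liouvilleL (hL : TypeIliouvilleL) (hν : 0 < ν) (hT : 0 < T)
    (hmax : IsMaximalSmoothSolution ν 0 u p T) (hLH : IsLerayHopfOn T ν 0 (u 0) u)
    (hdec : HasRapidSpatialDecay (u 0)) {S₁ : ℝ} (hS₁ : S₁ < ν * T) {W : ℝ≥0∞} (hW : W ≠ ⊤)
    (hmeas : ∀ s ∈ Ioo S₁ (ν * T), AEStronglyMeasurable (timeRescale ν⁻¹ ν⁻¹ u s) volume)
    (hbd : ∀ s ∈ Ioo S₁ (ν * T), eWeakLpPow (timeRescale ν⁻¹ ν⁻¹ u s) 3 volume ≤ W) :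
    IsTypeIBlowup u T := by
  have hI : volume (ball (0 : EuclideanSpace ℝ (Fin 3)) 1) + 2 * W ≠ ⊤ :=
    ENNReal.add_ne_top.2 ⟨measure_ball_lt_top.ne, ENNReal.mul_ne_top (by norm_num) hW⟩
  exact isTypeIBlowup_of_cknAEssSlab_of_liouvilleL hL hν hT hmax hLH hdec hS₁ hI
    fun r hr z hQ => cknAEss_le_of_eWeakLpPow_le hmeas hbd hr hQ

/-- Slices of the normalised field at times `s ∈ (0, νT)` are continuous, hence a.e.-strongly
measurable, for a classical solution on `[0, T)`. [folklore] -/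
theorem aestronglyMeasurable_timeRescale_slice (hν : 0 < ν)
    (hsol : IsClassicalNSSolutionOn (Ico 0 T) ν 0 u p) {s : ℝ} (hs : s ∈ Ioo 0 (ν * T)) :
    AEStronglyMeasurable (timeRescale ν⁻¹ ν⁻¹ u s) volume := by
  have ht : ν⁻¹ * s ∈ Ico 0 T := by
    refine ⟨mul_nonneg (inv_nonneg.2 hν.le) hs.1.le, ?_⟩
    rw [inv_mul_lt_iff₀ hν]
    exact hs.2
  have hc : Continuous (u (ν⁻¹ * s)) := (hsol.contDiff_velocity ht).continuous
  have e : timeRescale ν⁻¹ ν⁻¹ u s = fun x => ν⁻¹ • u (ν⁻¹ * s) x :=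
    funext fun x => timeRescale_apply _ _ _ _ _
  rw [e]
  exact (hc.const_smul ν⁻¹).aestronglyMeasurable

/-- **(L) implies the critical weak-`L³` continuation criterion.**  Under KNSS's Liouville
conjecture (L): a classical solution of Navier–Stokes on `ℝ³ × [0, T)`, Leray–Hopf from a rapidly
decaying datum, whose normalised slices obey `eWeakLpPow (ũ s) 3 ≤ W ≠ ∞` for `s ∈ (S₁, νT)` with
`0 ≤ S₁ < νT` (i.e. `sup ‖u(t)‖_{L^{3,∞}} < ∞` on a final time interval), is NOT maximal at `T`:
(L) gives it the Type-I rate (`isTypeIBlowup_of_weakL3Slab_of_liouvilleL`) and (L) forbids the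
Type-I rate for maximal solutions (`typeILiouville_typeIliouvilleLKillsTypeI_proof`). [cite: KochNadirashviliSereginSverak2009, §1 conjecture (L) and §6 (arXiv:0709.3599)] -/
theorem not_isMaximal_of_weakL3Slab_of_liouvilleL (hL : TypeIliouvilleL) (hν : 0 < ν) (hT : 0 < T)
    (hLH : IsLerayHopfOn T ν 0 (u 0) u) (hdec : HasRapidSpatialDecay (u 0))
    {S₁ : ℝ} (hS₁0 : 0 ≤ S₁) (hS₁ : S₁ < ν * T) {W : ℝ≥0∞} (hW : W ≠ ⊤)
    (hbd : ∀ s ∈ Ioo S₁ (ν * T), eWeakLpPow (timeRescale ν⁻¹ ν⁻¹ u s) 3 volume ≤ W) :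
    ¬ IsMaximalSmoothSolution ν 0 u p T := by
  intro hmax
  have hmeas : ∀ s ∈ Ioo S₁ (ν * T), AEStronglyMeasurable (timeRescale ν⁻¹ ν⁻¹ u s) volume :=
    fun s hs => aestronglyMeasurable_timeRescale_slice hν hmax.1 ⟨hS₁0.trans_lt hs.1, hs.2⟩
  exact typeILiouville_typeIliouvilleLKillsTypeI_proof hL ν T hν hT u p hmax hLH hdec
    (isTypeIBlowup_of_weakL3Slab_of_liouvilleL hL hν hT hmax hLH hdec hS₁ hW hmeas hbd)

/-- **(L) ⇒ weak-`L³` continuation**, positive form: under (L), a classical Leray–Hopf solution on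
`[0, T)` from a rapidly decaying datum with a weak-`L³` bound on a final slab extends as a classical
solution past `T`. [cite: KochNadirashviliSereginSverak2009, §1 conjecture (L) (arXiv:0709.3599)] -/
theorem hasSmoothExtensionPast_of_weakL3Slab_of_liouvilleL (hL : TypeIliouvilleL) (hν : 0 < ν)
    (hT : 0 < T) (hsol : IsClassicalNSSolutionOn (Ico 0 T) ν 0 u p)
    (hLH : IsLerayHopfOn T ν 0 (u 0) u) (hdec : HasRapidSpatialDecay (u 0))
    {S₁ : ℝ} (hS₁0 : 0 ≤ S₁) (hS₁ : S₁ < ν * T) {W : ℝ≥0∞} (hW : W ≠ ⊤)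
    (hbd : ∀ s ∈ Ioo S₁ (ν * T), eWeakLpPow (timeRescale ν⁻¹ ν⁻¹ u s) 3 volume ≤ W) :
    HasSmoothExtensionPast ν 0 u T := by
  by_contra hext
  exact not_isMaximal_of_weakL3Slab_of_liouvilleL hL hν hT hLH hdec hS₁0 hS₁ hW hbd ⟨hsol, hext⟩

end Summit.NavierStokesRegularity.NavierStokesRegularity.Theorems.TypeIliouvilleNoTypeII.TypeIIZoom

end
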